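import Mathlib
import HarnessLib
import Summits.Ventures.LatticeQCDFlow.Scaling.AcceptanceJensenFloorIntegral
import Literature.MathematicalPhysics.QuantumFieldTheory.WilsonEnergyConvexity

/-!
# LatticeQCDFlow / Scaling — a GLOBAL acceptance floor for the untrained sampler of a tilt family:
# `acc(β) ≥ exp(−D(μ ‖ μ_β) − |β|·½E_{μ⊗μ}|T − T′|)` with `D(μ ‖ μ_β) = log Z(β) − β·E_μ T ≥ 0`

HONEST FRAMING: exact (Metropolis-corrected) sampling algorithms for lattice gauge theory;
figures of merit are autocorrelation/cost numbers at stated couplings and volumes; no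
continuum-physics claim.

Venture `LatticeQCDFlow` (cell pub-lqcd), topic `Scaling`; FANOUT row 3 (`s0-u1-a`, S0-B
implementation A, GEN-18).  NEW WORK of the cell (assembly), not a published result; NO definition is
introduced.  Parent: row 3's general-space JENSEN FLOOR `Scaling/AcceptanceJensenFloorIntegral`
(GEN-11: `acc ≥ exp(E_ν[log w] − ½E_{ν⊗ν}|log w − log w′|)`), read at the untrained (identity-flow)
sampler of a Boltzmann tilt: proposal law `μ` (a probability measure), target `e^{βT}μ/Z(β)`,
`Z(β) = ∫ e^{βT} dμ`.  Its log-weight `βT − log Z(β)` is AFFINE in the statistic, so the two Jensen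
monitors are the relative entropy `D(μ ‖ μ_β) = log Z(β) − β·E_μT` (`≥ 0`, Jensen) and `|β|` times the
strong-coupling slope `s = ½E_{μ⊗μ}|T − T′|` of row 3's `Scaling/IdentityFlowAcceptanceStrongCoupling`:

* `log_integral_exp_sub_mul_integral_nonneg` — `0 ≤ log Z(β) − β·E_μ T`;
* **`tiltIMH_exp_le_meanAccept`** — for every real `β` with `e^{βT} ∈ L¹(μ)` and `T ∈ L¹(μ)`:
  `exp(−(log Z(β) − β·E_μT) − |β|·½∫∫|T x − T y| dμ dμ) ≤ acc(β) = (∫∫ min(e^{βT x}, e^{βT y}) dμ dμ)/Z(β)`;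
  `tiltIMH_one_sub_le_meanAccept` — the linear form `1 − D − |β| s ≤ acc(β)`;
* **`wilsonIdentityFlow_exp_le_meanAccept`** — Wilson lattice gauge theory, every compact `G`,
  continuous `ρ`, `d`, `L`, reference probability law `μ` (the form of `Scaling/WilsonIdentityFlowLaw`):
  `exp(−(log ∫e^{−βS}dμ + β·E_μS) − |β|·½∫∫|S − S′| dμ dμ) ≤ acc(β)`.

Reading (value-free): with GEN-16's ceiling `acc(β) ≤ Z(β/2)²/Z(β)` this brackets the untrained
sampler's acceptance at EVERY coupling between two explicit functionals of the free energy and the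
Gini mean difference of the action under the proposal law; the transfer version (proposal `μ_{β₀}`) is
`Scaling/WilsonTransferAcceptanceFloor`.  NOT CLAIMED: sharpness; any value at the cell's `(β, L)`.
-/

noncomputable section

namespace Summit.Ventures.LatticeQCDFlow.Theory2

open MeasureTheory Real Set ProbabilityTheory Filter Topology

/-! ## §1 Tilt families -/

section Tilt

variable {Ω : Type*} [MeasurableSpace Ω] {μ : Measure Ω} [IsProbabilityMeasure μ] {T : Ω → ℝ}

/-- **`0 ≤ log ∫e^{βT}dμ − β·∫T dμ`** (Jensen for `exp`; this is `D(μ ‖ e^{βT}μ/Z)`). [folklore] -/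
theorem log_integral_exp_sub_mul_integral_nonneg (hTi : Integrable T μ) (β : ℝ)
    (hβ : Integrable (fun x => Real.exp (β * T x)) μ) :
    0 ≤ Real.log (∫ x, Real.exp (β * T x) ∂μ) - β * ∫ x, T x ∂μ := by
  have hJ := (convexOn_exp.map_integral_le (μ := μ) (f := fun x => β * T x)
    Real.continuous_exp.continuousOn isClosed_univ (ae_of_all _ fun _ => mem_univ _)
    (hTi.const_mul β) hβ)
  rw [integral_const_mul] at hJ
  have hpos : 0 < ∫ x, Real.exp (β * T x) ∂μ := integral_exp_pos hβ
  have h := Real.log_le_log (Real.exp_pos _) hJ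
  rw [Real.log_exp] at h
  linarith

/-- **GLOBAL JENSEN FLOOR FOR THE UNTRAINED SAMPLER OF A TILT FAMILY**: for every real `β` with
`e^{βT}, T ∈ L¹(μ)`,
`exp(−(log Z(β) − β·E_μT) − |β|·½∫∫|T x − T y| dμ dμ) ≤ (∫∫ min(e^{βT x}, e^{βT y}) dμ dμ)/Z(β)`,
the equilibrium acceptance of `μ`-proposals against the tilt `e^{βT}μ/Z(β)`. [ours] -/
theorem tiltIMH_exp_le_meanAccept (hTm : Measurable T) (hTi : Integrable T μ) (β : ℝ)
    (hβ : Integrable (fun x => Real.exp (β * T x)) μ) :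
    Real.exp (-(Real.log (∫ x, Real.exp (β * T x) ∂μ) - β * ∫ x, T x ∂μ)
        - |β| * (1 / 2 * ∫ x, ∫ y, |T x - T y| ∂μ ∂μ))
      ≤ (∫ x, ∫ y, min (Real.exp (β * T x)) (Real.exp (β * T y)) ∂μ ∂μ)
          / ∫ x, Real.exp (β * T x) ∂μ := by
  set Z : ℝ := ∫ x, Real.exp (β * T x) ∂μ with hZ
  have hZ0 : 0 < Z := integral_exp_pos hβ
  -- target density `p = e^{βT}/Z` against `μ`, model density `1`
  set p : Ω → ℝ := fun x => Real.exp (β * T x) / Z with hp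
  have hp0 : ∀ x, 0 < p x := fun x => div_pos (Real.exp_pos _) hZ0
  have hpm : Measurable p := (Real.measurable_exp.comp (measurable_const.mul hTm)).div_const _
  have hpi : Integrable p μ := hβ.div_const _
  have hν : (μ.withDensity fun _ : Ω => ENNReal.ofReal (1 : ℝ)) = μ := by
    rw [show (fun _ : Ω => ENNReal.ofReal (1 : ℝ)) = (1 : Ω → ENNReal) from funext fun _ => by simp,
      withDensity_one]
  haveI : IsProbabilityMeasure (μ.withDensity fun _ : Ω => ENNReal.ofReal (1 : ℝ)) := by
    rw [hν]; infer_instance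
  have hlogp : ∀ x, Real.log (p x / 1) = β * T x - Real.log Z := fun x => by
    rw [div_one, hp]
    simp only
    rw [Real.log_div (Real.exp_pos _).ne' hZ0.ne', Real.log_exp]
  have hℓi : Integrable (fun x => Real.log (p x / (fun _ : Ω => (1 : ℝ)) x))
      (μ.withDensity fun x => ENNReal.ofReal ((fun _ : Ω => (1 : ℝ)) x)) := by
    simp only
    rw [hν]
    refine ((hTi.const_mul β).sub (integrable_const (Real.log Z))).congr (ae_of_all _ fun x => ?_)
    simp only [Pi.sub_apply]
    rw [hlogp x]
  have hJ := exp_integral_log_sub_half_mad_le_meanAccept (μ := μ) (p := p) (q := fun _ : Ω => (1 : ℝ))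
    hp0 hpm hpi (fun _ => one_pos) measurable_const (integrable_const _) hℓi
  simp only [mul_one] at hJ
  rw [hν] at hJ
  have hI1 : ∫ x, Real.log (p x / 1) ∂μ = -(Real.log Z - β * ∫ x, T x ∂μ) := by
    simp_rw [hlogp]
    rw [integral_sub (hTi.const_mul _) (integrable_const _), integral_const_mul, integral_const,
      probReal_univ, one_smul]
    ring
  have hI2 : ∫ x, ∫ y, |Real.log (p x / 1) - Real.log (p y / 1)| ∂μ ∂μ
      = |β| * ∫ x, ∫ y, |T x - T y| ∂μ ∂μ := by
    simp_rw [hlogp]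
    have e : ∀ x y : Ω, |β * T x - Real.log Z - (β * T y - Real.log Z)| = |β| * |T x - T y| :=
      fun x y => by rw [show β * T x - Real.log Z - (β * T y - Real.log Z) = β * (T x - T y) by ring, abs_mul]
    simp_rw [e, integral_const_mul]
  rw [hI1, hI2] at hJ
  -- the acceptance: `∫∫ min(p x, p y) = (∫∫ min(e^{βTx}, e^{βTy}))/Z`
  have hA : ∫ x, ∫ y, min (p x) (p y) ∂μ ∂μ
      = (∫ x, ∫ y, min (Real.exp (β * T x)) (Real.exp (β * T y)) ∂μ ∂μ) / Z := by
    have e : ∀ x y, min (p x) (p y) = min (Real.exp (β * T x)) (Real.exp (β * T y)) / Z := fun x y => by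
      rw [hp]; simp only; rw [min_div_div_right (le_of_lt hZ0)]
    simp_rw [e, integral_div]
  rw [hA] at hJ
  have e3 : -(Real.log Z - β * ∫ x, T x ∂μ) - |β| * (∫ x, ∫ y, |T x - T y| ∂μ ∂μ) / 2
      = -(Real.log Z - β * ∫ x, T x ∂μ) - |β| * (1 / 2 * ∫ x, ∫ y, |T x - T y| ∂μ ∂μ) := by ring
  rw [e3] at hJ
  exact hJ

/-- **LINEAR FORM**: `1 − (log Z(β) − β·E_μT) − |β|·½∫∫|T x − T y| dμ dμ ≤ acc(β)`. [ours] -/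
theorem tiltIMH_one_sub_le_meanAccept (hTm : Measurable T) (hTi : Integrable T μ) (β : ℝ)
    (hβ : Integrable (fun x => Real.exp (β * T x)) μ) :
    1 - (Real.log (∫ x, Real.exp (β * T x) ∂μ) - β * ∫ x, T x ∂μ)
        - |β| * (1 / 2 * ∫ x, ∫ y, |T x - T y| ∂μ ∂μ)
      ≤ (∫ x, ∫ y, min (Real.exp (β * T x)) (Real.exp (β * T y)) ∂μ ∂μ)
          / ∫ x, Real.exp (β * T x) ∂μ := by
  refine le_trans ?_ (tiltIMH_exp_le_meanAccept hTm hTi β hβ)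
  have h := Real.add_one_le_exp (-(Real.log (∫ x, Real.exp (β * T x) ∂μ) - β * ∫ x, T x ∂μ)
        - |β| * (1 / 2 * ∫ x, ∫ y, |T x - T y| ∂μ ∂μ))
  linarith

end Tilt

/-! ## §2 Wilson lattice gauge theory, any reference law -/

section Wilson

open Literature.MathematicalPhysics.QuantumFieldTheory

variable {d L N : ℕ} [NeZero L] {G : Type*} [Group G] [TopologicalSpace G] [IsTopologicalGroup G]
  [CompactSpace G] [MeasurableSpace G] [BorelSpace G] (ρ : G →* Matrix (Fin N) (Fin N) ℂ)
  (μ : Measure (GaugeConfig d L G)) [IsProbabilityMeasure μ]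

/-- **GLOBAL FLOOR FOR THE UNTRAINED WILSON SAMPLER** (every compact `G`, continuous `ρ`, `d`, `L`,
reference probability law `μ`, every real `β`):
`exp(−(log ∫e^{−βS}dμ + β·E_μS) − |β|·½∫∫|S(U) − S(U′)| dμ dμ) ≤ acc(β)`, the acceptance of
`Scaling/WilsonIdentityFlowLaw` (`μ`-proposals against `e^{−βS}μ/Z_μ(β)`). [ours] -/
theorem wilsonIdentityFlow_exp_le_meanAccept (hρ : Continuous ρ) (β : ℝ) :
    Real.exp (-(Real.log (∫ U, Real.exp (-β * wilsonAction ρ U) ∂μ) + β * ∫ U, wilsonAction ρ U ∂μ)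
        - |β| * (1 / 2 * ∫ U, ∫ U', |wilsonAction ρ U - wilsonAction ρ U'| ∂μ ∂μ))
      ≤ (∫ U, ∫ U', min (Real.exp (-β * wilsonAction ρ U)) (Real.exp (-β * wilsonAction ρ U')) ∂μ ∂μ)
          / ∫ U, Real.exp (-β * wilsonAction ρ U) ∂μ := by
  have hSm : Measurable fun U : GaugeConfig d L G => -wilsonAction ρ U :=
    (WilsonRP.measurable_wilsonAction (d := d) (L := L) ρ hρ).neg
  have hSi : Integrable (fun U : GaugeConfig d L G => -wilsonAction ρ U) μ :=
    (integrable_wilsonAction (d := d) (L := L) ρ hρ μ).neg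
  have hint : Integrable (fun U : GaugeConfig d L G => Real.exp (β * -wilsonAction ρ U)) μ := by
    simpa only [mul_neg, neg_mul] using integrable_exp_mul_wilsonAction (d := d) (L := L) ρ hρ (-β) μ
  have h := tiltIMH_exp_le_meanAccept (μ := μ) hSm hSi β hint
  have habs : (fun U : GaugeConfig d L G => ∫ U', |-wilsonAction ρ U - -wilsonAction ρ U'| ∂μ)
      = fun U => ∫ U', |wilsonAction ρ U - wilsonAction ρ U'| ∂μ := by
    funext U; congr 1; funext U'
    rw [show -wilsonAction ρ U - -wilsonAction ρ U' = -(wilsonAction ρ U - wilsonAction ρ U') by ring, abs_neg]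
  rw [habs, integral_neg] at h
  simp only [mul_neg, neg_mul] at h ⊢
  convert h using 3
  ring

end Wilson

end Summit.Ventures.LatticeQCDFlow.Theory2
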